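import Summits.QuantumFields.BalabanUV.T4Continuum.Support.SubstrateChartRealSlice

/-!
# SUBSTRATE — [dict] D-8: THE `hslice` LETTER OF THE SUBSTRATE's OWN SPECIES ALONG THE REAL-SLICE DISC (typer NEXT gen 8 item 2 ∕ LIBRARY L-E10 species
# corollary; NE5 owner g35-d `OutputRateComplexSlice.operatorRate_complex_of_realSlice(_each)` binder `hslice`): for families on GLOBAL chart points read
# through `chi` — the GREEN OPERATOR (matrix-valued, bound `4∕γ` PROVED) and the covariance entries (analyticity PROVED, bound DISPLAYED) — the five clauses
# `∃ γ z₀, ‖z₀‖ ≤ r ∧ γ z₀ = u ∧ (real diameter ⊆ unitaryLev) ∧ DiffContOnCl ℂ (F ∘ γ) (ball 0 1) ∧ closed-disc bound` at every `u = expChartT P R⁰ A`,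
# `(1 + r⁻¹)·‖A‖ < rhoLev`

Cell `pub-balaban`, SUBSTRATE cell, seat `b2b-balaban-substrate-p1` (gen 3).  Summits-side under the LEAN PLACEMENT RULE.  Follower of `SubstrateChartRealSlice`
(p225653; `hslice_sliceDisc` = typer W14d3) — composition BY NAME with p221513 (`analyticAt_greenT`, `analyticAt_expChartT_apply`), p223952 (`rhoLev`,
`mem_regularSetAt_of_norm_lt_rhoLev`, `analyticOnNhd_covAtTLev_printed_on_ballExplicit`, `opNorm_greenT_le_on_ballExplicit`), p224186 (`chi_expChartT_of_unitary`).
HONEST FRAMING: rung (B)+1 of the FINITE-VOLUME T⁴ programme — NOT infinite volume, NOT a mass gap, NOT Clay; spine PROVED 0∕9; NE5 NOT PRINTED ∕ NOT proved;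
0 analysis of Bałaban's: the Green bound `4∕γ` is p3's form-relative count, the covariance-ENTRY bound is a DISPLAYED letter (no entry bound of `unitCovT` is in
the tree), the ℰ-families' letter is never substrate (θ8); `rOp k`, `B`, `r`, `dom` are the consumer's letters.  HONEST DEPENDENCY (cell line, verbatim):
continuum YM on T⁴ ⇐ BetaPertH ∧ nine spine estimates (0/9 proved); BetaPertH ⇐ (D1) ∧ (D4) ∧ CAP+tail; G-an2-4 gates asym, D1 and NE2/3/4.

WHAT.  §1 `analyticOnNhd_greenT_expChartT` (matrix-valued, on `regularSetAt`, p221513 BY NAME), `analyticOnNhd_greenT_printed_on_ballExplicit` (on `ball 0 rhoLev`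
at the printed letters); §2 `hslice_chi` (W14d3 for families `G ∘ chi P`, pull-back rewritten by `chi_expChartT_of_unitary`); §3 **`hslice_greenT_chi`** (ALL
FIVE CLAUSES PROVED for the level-`k` Green operator read through `chi`, `C := 4∕γ`) and **`hslice_covAtTLev_chi`** (five clauses for a covariance ENTRY read
through `chi`, its closed-disc bound DISPLAYED as `hC`).
-/

noncomputable section

open scoped BigOperators ComplexConjugate Matrix Matrix.Norms.L2Operator Kronecker ComplexOrder
open Complex (I)

namespace Summit.QuantumFields.BalabanUV.T4Continuum.SubstrateChartRealSliceSpecies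

open Literature.MathematicalPhysics.QuantumFieldTheory.Balaban1983to89
open Literature.MathematicalPhysics.QuantumFieldTheory.Balaban1983to89.B5Prop11Plancherel (Tor fine)
open Literature.MathematicalPhysics.QuantumFieldTheory.Balaban1983to89.B5G183RateUnitTower (lev lev_neZero)
open Summit.QuantumFields.BalabanUV.T4Continuum
open Summit.QuantumFields.BalabanUV.T4Continuum.CoerciveInverseTower (Coercive)
open Summit.QuantumFields.BalabanUV.T4Continuum.CovariantVectorCoercive (vecOp)
open Summit.QuantumFields.BalabanUV.T4Continuum.SubstrateBackgroundTransporters (unitMod)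
open Summit.QuantumFields.BalabanUV.T4Continuum.SubstrateTransporterSpecies
open Summit.QuantumFields.BalabanUV.T4Continuum.SubstrateTransporterSpeciesHolo (expChartT expChartInvT regularSetAt)
open Summit.QuantumFields.BalabanUV.T4Continuum.SubstrateTransporterSpeciesAnalytic (analyticAt_greenT analyticAt_expChartT_apply analyticAt_expChartInvT_apply)
open Summit.QuantumFields.BalabanUV.T4Continuum.SubstrateTransporterSpeciesLev (cPr aPr covAtTLev)
open Summit.QuantumFields.BalabanUV.T4Continuum.SubstrateTransporterSpeciesLevExplicit (rhoLev mem_regularSetAt_of_norm_lt_rhoLev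
  analyticOnNhd_covAtTLev_printed_on_ballExplicit opNorm_greenT_le_on_ballExplicit)
open Summit.QuantumFields.BalabanUV.T4Continuum.SubstrateChartSection (chi chi_expChartT_of_unitary)
open Summit.QuantumFields.BalabanUV.T4Continuum.SubstrateChartRealSlice (unitaryLev sliceDisc hslice_sliceDisc)
open Summit.QuantumFields.BalabanUV.T4Continuum.CovariantBlockAveraging (ContourSystem)

variable (P : Params) {o : Type*} [Fintype o] [DecidableEq o]
variable (c : ℂ) (a : ℝ) (Γ : (k : ℕ) → ContourSystem P.d (lev P.L k) (unitMod P))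

/-! ## §1 The Green operator along the tower chart is analytic (matrix-valued) -/

/-- [folklore] **THE LEVEL-`k` GREEN OPERATOR ALONG THE TOWER CHART IS ANALYTIC ON THE LEVEL-`k` REGULAR SET** (matrix-valued; p221513 `analyticAt_greenT` with
the chart coordinates `analyticAt_expChartT_apply ∕ analyticAt_expChartInvT_apply`). -/
theorem analyticOnNhd_greenT_expChartT (R₀ : TowerData P o) (k : Fin (P.K + 1)) :
    AnalyticOnNhd ℂ (fun A : TowerData P o => greenT (lev P.L k) (unitMod P) c a (Γ k) (expChartT P R₀ A k) (expChartInvT P R₀ A k))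
      (regularSetAt P c a Γ R₀ k) := fun A₀ hA₀ =>
  analyticAt_greenT (lev P.L k) (unitMod P) (fun ν i => analyticAt_expChartT_apply P R₀ k ν i A₀)
    (fun ν i => analyticAt_expChartInvT_apply P R₀ k ν i A₀) hA₀

section Explicit

variable [Nonempty o] {R₀ : TowerData P o} (hR₀ : ∀ (k : Fin (P.K + 1)) ν i, R₀ k ν i ∈ Matrix.unitaryGroup o ℂ) {a' γ : ℝ} (ha' : 0 ≤ a')
  (hco : ∀ k : Fin (P.K + 1), Coercive γ (vecOp (lev P.L k) (unitMod P) a' (Γ k) (R₀ k))) (hγ : 0 < γ)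
  {ℓ : Fin (P.K + 1) → ℕ} (hΓ : ∀ (k : Fin (P.K + 1)) y j μ (t : Fin (lev P.L k)), (Γ k y j μ t).length ≤ ℓ k)
  (hℓ : ∀ k : Fin (P.K + 1), (ℓ k : ℝ) ≤ ((P.d : ℝ) + 1) * (lev P.L k : ℕ))

include hR₀ ha' hco hγ hΓ hℓ in
/-- [folklore] **… AND ON THE EXPLICIT BALL AT THE PRINTED LETTERS**: on `ball 0 rhoLev` the level-`k` Green operator along the chart is analytic
(`mem_regularSetAt_of_norm_lt_rhoLev`, p223952). -/
theorem analyticOnNhd_greenT_printed_on_ballExplicit (k : Fin (P.K + 1)) :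
    AnalyticOnNhd ℂ (fun A : TowerData P o => greenT (lev P.L k) (unitMod P) (cPr P k) (aPr P a' k) (Γ k) (expChartT P R₀ A k) (expChartInvT P R₀ A k))
      (Metric.ball (0 : TowerData P o) (rhoLev P (o := o) γ a')) :=
  (analyticOnNhd_greenT_expChartT P (cPr P k) (aPr P a' k) Γ R₀ k).mono fun _ hA =>
    (mem_regularSetAt_of_norm_lt_rhoLev P Γ hR₀ ha' hco hγ hΓ hℓ (mem_ball_zero_iff.1 hA) k).1

end Explicit

/-! ## §2 W14d3 for families read through `chi` -/

/-- [folklore] **THE `hslice` PACKAGE FOR A FAMILY READ THROUGH `chi`**: for a unitary centre `R⁰` and a family `G` of the TWO-SIDED pair whose pull-back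
along the exponential pair `A ↦ G (expChartT P R⁰ A, expChartInvT P R⁰ A)` is analytic and `C`-bounded on `ball 0 ρ`, the family `u ↦ G (chi P u)` on
GLOBAL chart points satisfies g35-d's five clauses at every `u = expChartT P R⁰ A` with `(1 + r⁻¹)·‖A‖ < ρ` (p225653 `hslice_sliceDisc`, pull-back
rewritten by p224186 `chi_expChartT_of_unitary`). -/
theorem hslice_chi {E : Type*} [NormedAddCommGroup E] [NormedSpace ℂ E] {R₀ : TowerData P o} (hR₀ : R₀ ∈ unitaryLev P o)
    (G : TowerData P o × TowerData P o → E) {ρ C r : ℝ} (hr : 0 < r)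
    (han : AnalyticOnNhd ℂ (fun A : TowerData P o => G (expChartT P R₀ A, expChartInvT P R₀ A)) (Metric.ball (0 : TowerData P o) ρ))
    (hbd : ∀ B ∈ Metric.ball (0 : TowerData P o) ρ, ‖G (expChartT P R₀ B, expChartInvT P R₀ B)‖ ≤ C) (A : TowerData P o)
    (hA : (1 + r⁻¹) * ‖A‖ < ρ) :
    ∃ γ : ℂ → TowerData P o, ∃ z₀ : ℂ, ‖z₀‖ ≤ r ∧ γ z₀ = expChartT P R₀ A ∧ (∀ x : ℝ, |x| < 1 → γ x ∈ unitaryLev P o) ∧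
      DiffContOnCl ℂ (fun z => G (chi P (γ z))) (Metric.ball (0 : ℂ) 1) ∧ ∀ z : ℂ, ‖z‖ ≤ 1 → ‖G (chi P (γ z))‖ ≤ C := by
  have hfun : (fun B : TowerData P o => G (chi P (expChartT P R₀ B))) = fun B => G (expChartT P R₀ B, expChartInvT P R₀ B) :=
    funext fun B => by rw [chi_expChartT_of_unitary P hR₀ B]
  have han' : AnalyticOnNhd ℂ (fun B : TowerData P o => G (chi P (expChartT P R₀ B))) (Metric.ball (0 : TowerData P o) ρ) := by rw [hfun]; exact han
  have hbd' : ∀ B ∈ Metric.ball (0 : TowerData P o) ρ, ‖G (chi P (expChartT P R₀ B))‖ ≤ C := fun B hB => by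
    rw [chi_expChartT_of_unitary P hR₀ B]; exact hbd B hB
  exact hslice_sliceDisc P hR₀ (fun u => G (chi P u)) hr han' hbd' A hA

/-! ## §3 The two species instances -/

section Species

variable [Nonempty o] {R₀ : TowerData P o} (hR₀ : ∀ (k : Fin (P.K + 1)) ν i, R₀ k ν i ∈ Matrix.unitaryGroup o ℂ) {a' γ : ℝ} (ha' : 0 ≤ a')
  (hco : ∀ k : Fin (P.K + 1), Coercive γ (vecOp (lev P.L k) (unitMod P) a' (Γ k) (R₀ k))) (hγ : 0 < γ)
  {ℓ : Fin (P.K + 1) → ℕ} (hΓ : ∀ (k : Fin (P.K + 1)) y j μ (t : Fin (lev P.L k)), (Γ k y j μ t).length ≤ ℓ k)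
  (hℓ : ∀ k : Fin (P.K + 1), (ℓ k : ℝ) ≤ ((P.d : ℝ) + 1) * (lev P.L k : ℕ))

include hR₀ ha' hco hγ hΓ hℓ in
/-- [folklore] **`hslice` FOR THE GREEN OPERATOR — ALL FIVE CLAUSES PROVED**: at the printed letters, for a unitary levelwise `γ`-coercive centre (ONE level-free
`γ`, `0 ≤ a′`, contour lengths), depth `0 < r`, the level-`k` Green operator read through `chi` on global chart points, `u ↦ greenT … ((chi P u).1 k) ((chi P u).2 k)`,
satisfies the five clauses with `C := 4∕γ` at every `u = expChartT P R⁰ A`, `(1 + r⁻¹)·‖A‖ < rhoLev P γ a′`. -/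
theorem hslice_greenT_chi {r : ℝ} (hr : 0 < r) (k : Fin (P.K + 1)) (A : TowerData P o) (hA : (1 + r⁻¹) * ‖A‖ < rhoLev P (o := o) γ a') :
    ∃ γc : ℂ → TowerData P o, ∃ z₀ : ℂ, ‖z₀‖ ≤ r ∧ γc z₀ = expChartT P R₀ A ∧ (∀ x : ℝ, |x| < 1 → γc x ∈ unitaryLev P o) ∧
      DiffContOnCl ℂ (fun z => greenT (lev P.L k) (unitMod P) (cPr P k) (aPr P a' k) (Γ k) ((chi P (γc z)).1 k) ((chi P (γc z)).2 k))
        (Metric.ball (0 : ℂ) 1) ∧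
      ∀ z : ℂ, ‖z‖ ≤ 1 → ‖greenT (lev P.L k) (unitMod P) (cPr P k) (aPr P a' k) (Γ k) ((chi P (γc z)).1 k) ((chi P (γc z)).2 k)‖ ≤ 4 / γ :=
  hslice_chi P (fun k ν i => hR₀ k ν i) (fun RS => greenT (lev P.L k) (unitMod P) (cPr P k) (aPr P a' k) (Γ k) (RS.1 k) (RS.2 k)) hr
    (analyticOnNhd_greenT_printed_on_ballExplicit P Γ hR₀ ha' hco hγ hΓ hℓ k)
    (fun _ hB => opNorm_greenT_le_on_ballExplicit P Γ hR₀ ha' hco hγ hΓ hℓ hB k) A hA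

variable (s : ℕ → ℂ)

include hR₀ ha' hco hγ hΓ hℓ in
/-- [folklore] **`hslice` FOR A COVARIANCE ENTRY** read through `chi`: the analyticity clause is PROVED (p223952), the closed-disc bound is the DISPLAYED
letter `hC` (a bound of the entry on `ball 0 rhoLev` — no entry bound of `unitCovT` is in the tree; the consumer's `B·rOp k`). -/
theorem hslice_covAtTLev_chi {r : ℝ} (hr : 0 < r) (k : ℕ) {T : Type*} (t : T) (b b' : (Tor (unitMod P) × Fin P.d) × o) {C : ℝ}
    (hC : ∀ B ∈ Metric.ball (0 : TowerData P o) (rhoLev P (o := o) γ a'),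
      ‖covAtTLev P (cPr P) (aPr P a') Γ s (expChartT P R₀ B) (expChartInvT P R₀ B) k t b b'‖ ≤ C)
    (A : TowerData P o) (hA : (1 + r⁻¹) * ‖A‖ < rhoLev P (o := o) γ a') :
    ∃ γc : ℂ → TowerData P o, ∃ z₀ : ℂ, ‖z₀‖ ≤ r ∧ γc z₀ = expChartT P R₀ A ∧ (∀ x : ℝ, |x| < 1 → γc x ∈ unitaryLev P o) ∧
      DiffContOnCl ℂ (fun z => covAtTLev P (cPr P) (aPr P a') Γ s (chi P (γc z)).1 (chi P (γc z)).2 k t b b') (Metric.ball (0 : ℂ) 1) ∧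
      ∀ z : ℂ, ‖z‖ ≤ 1 → ‖covAtTLev P (cPr P) (aPr P a') Γ s (chi P (γc z)).1 (chi P (γc z)).2 k t b b'‖ ≤ C :=
  hslice_chi P (fun k ν i => hR₀ k ν i) (fun RS => covAtTLev P (cPr P) (aPr P a') Γ s RS.1 RS.2 k t b b') hr
    (analyticOnNhd_covAtTLev_printed_on_ballExplicit P Γ hR₀ ha' hco hγ hΓ hℓ s k t b b') hC A hA

end Species

end Summit.QuantumFields.BalabanUV.T4Continuum.SubstrateChartRealSliceSpecies

end
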